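import Summits.ResolutionOfSingularities.ResolutionOfSingularities.Theorems.FrobeniusLadderFInjectiveMacaulayficationDoublePointFermatCubicGerm
import HarnessLib

/-!
# NON-VACUITY of the germ instances: the vertices are BAD points — the crux's stalk clause FAILS at `𝒪_{X,v}` (Fedder)
# (crux `FInjectiveMacaulayfication` stmt-ResolutionOfSingularities-15315, chain w45a; res-L1-w45a-stub-1 g9, completion of OFFERS (B)/(C): a germ instance
# `FInjectivizationGermAt p v` at a point whose local ring is already FULL would be vacuous (`𝓚 = ⊤`); this file certifies in the kernel that the two
# instance families sit at NON-FULL points; seat res-L1-w45a-stub-1 g9)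

[OURS · L1 W4.5a] Support file (`--supports stmt-ResolutionOfSingularities-15315 --as helper`); replaces the role of NO printed item; NOT a
statement of the manuscript; def-free, unconditional; a CERTIFICATE. AI-written (AI review is weaker than expert review).

## What is here
* §1 (generic) `not_fullCl_stalk_origin_of_fedder_mem` — **Fedder's criterion, necessity, at the origin of a hypersurface, in scheme vocabulary**: for
  `f ∈ k[X₀,…,X_{n−1}]`, `f ≠ 0`, `f(0) = 0`, `char k = p`, if `f^{p−1} ∈ (X₀^p, …, X_{n−1}^p)` then the stalk of `X = Spec k[X]/(f)` at the origin `v` is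
  NOT FULL (`¬ SliceableCentre.FullCl p 𝒪_{X,v}`: some parameter ideal is not Frobenius closed) — `FedderAtMaximalIdeal.fedder_criterion_maximalIdeal`
  transported along `k[X]_{(X)}/(f) ≅ (k[X]/(f))_{(x̄)} ≅ 𝒪_{X,v}`.
* §2 `fermatCubicCone_vertex_not_fullCl` (`f = Σ xₗ³ = Σ xₗ·xₗ² ∈ 𝔪^{[2]}`, `p = 2`) and `doublePoint_vertex_not_fullCl` (`f = x₀² + Σ x_{l+1}·x_{l+1}² ∈ 𝔪^{[2]}`,
  `p = 2`): the vertices of BOTH instance families (p599694 trivial stratum; p600638 + p601544 + p602043 informative stratum) are BAD points of the crux's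
  currency — so `FInjectivizationGermAt 2 v` there is NOT the vacuous instance `𝓚 = ⊤`.
* §3 ★ `fermatCubicCone_vertex_bad_germ_instance`, ★ `doublePoint_vertex_bad_germ_instance` — the headline conjunctions of p599694 / p601544 with the extra conjunct
  `¬ FullCl 2 𝒪_{X,v}` in front.

[folklore mathematics, OURS as a certificate; cite: Fedder1983, Prop. 1.7 and Thm. 1.12]
-/

-- single-problem summit: the doubled namespace component is forced
set_option linter.dupNamespace false

noncomputable section

open AlgebraicGeometry CategoryTheory Literature.AlgebraicGeometry.Resolution TopologicalSpace IsLocalRing MvPolynomial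

namespace Summit.ResolutionOfSingularities.ResolutionOfSingularities.Theorems.FInjectiveMacaulayfication.HypersurfaceOriginNotFull

open Summit.ResolutionOfSingularities.ResolutionOfSingularities.Theorems.FInjectiveMacaulayfication
open SliceableCentre GermForm GermOfGlobalBlowup

/-! ## §1 Fedder's necessity at the origin, scheme vocabulary -/

/-- **If `f^{p−1} ∈ (X₀^p, …, X_{n−1}^p)` then the origin of `Spec k[X]/(f)` is NOT a FULL point** (`f ≠ 0`, `f(0) = 0`): Fedder's criterion at the maximal
ideal `(X₀, …, X_{n−1})` (`FedderAtMaximalIdeal.fedder_criterion_maximalIdeal`, necessity) says the CM + Frobenius-closed clause fails for `k[X]_{(X)}/(f)`,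
and that ring is the stalk `𝒪_{X,v}` (`QuotLocalizationIso`, `IsLocalization.algEquiv`). [cite: Fedder1983, Prop. 1.7 and Thm. 1.12] -/
theorem not_fullCl_stalk_origin_of_fedder_mem (p : ℕ) [Fact p.Prime] (k : Type) [Field k] [CharP k p] {n : ℕ}
    (f : MvPolynomial (Fin n) k) (hf0 : f ≠ 0) (h0 : constantCoeff f = 0)
    (hfed : f ^ (p - 1) ∈ Ideal.span (Set.range fun i : Fin n => (X i : MvPolynomial (Fin n) k) ^ p))
    (v : Spec (.of (MvPolynomial (Fin n) k ⧸ Ideal.span {f})))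
    (hv : v.asIdeal = Ideal.span (Set.range fun j : Fin n => Ideal.Quotient.mk (Ideal.span {f}) (X j))) :
    ¬ FullCl p ((Spec (.of (MvPolynomial (Fin n) k ⧸ Ideal.span {f}))).presheaf.stalk v) := by
  intro hfull
  -- the maximal ideal `P = (X₀, …, X_{n−1})` upstairs
  have hP : v.asIdeal.comap (Ideal.Quotient.mk (Ideal.span {f})) = Ideal.span (Set.range (X : Fin n → MvPolynomial (Fin n) k)) := by
    rw [hv, DoublePointFermatCubicGerm.comap_origin k f h0]
  haveI hPmax : (v.asIdeal.comap (Ideal.Quotient.mk (Ideal.span {f}))).IsMaximal := by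
    rw [hP]
    exact QuotientOriginMaximal.idealOfVars_isMaximal k (n := n)
  have hfP : f ∈ v.asIdeal.comap (Ideal.Quotient.mk (Ideal.span {f})) := FermatCubicConeChar2.self_mem_comap f v.asIdeal
  -- `𝒪_{X,v} ≅ (k[X]/(f))_{(x̄)} ≅ k[X]_{(X)}/(f)`
  letI : Algebra (MvPolynomial (Fin n) k ⧸ Ideal.span {f}) ((Spec (.of (MvPolynomial (Fin n) k ⧸ Ideal.span {f}))).presheaf.stalk v) :=
    (StructureSheaf.toStalk (MvPolynomial (Fin n) k ⧸ Ideal.span {f}) v).hom.toAlgebra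
  have hloc : IsLocalization.AtPrime ((Spec (.of (MvPolynomial (Fin n) k ⧸ Ideal.span {f}))).presheaf.stalk v) v.asIdeal :=
    StructureSheaf.IsLocalization.to_stalk (MvPolynomial (Fin n) k ⧸ Ideal.span {f}) v
  have hfull' : FullCl p (Localization.AtPrime v.asIdeal) :=
    WFixAtNonClosedDimTwo.fullCl_of_ringEquiv p
      (IsLocalization.algEquiv v.asIdeal.primeCompl ((Spec (.of (MvPolynomial (Fin n) k ⧸ Ideal.span {f}))).presheaf.stalk v)
        (Localization.AtPrime v.asIdeal)).toRingEquiv hfull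
  obtain ⟨e₁⟩ := QuotLocalizationIso.stub_quotLocalizationIso (MvPolynomial (Fin n) k) f
    (v.asIdeal.comap (Ideal.Quotient.mk (Ideal.span {f}))) v.asIdeal rfl
  have hup := DegreeZeroDescent.inlineClause_of_ringEquiv p e₁.symm hfull'.2
  -- Fedder, necessity
  exact (FedderAtMaximalIdeal.fedder_criterion_maximalIdeal k n n p (v.asIdeal.comap (Ideal.Quotient.mk (Ideal.span {f}))) X hP f hfP hf0).mp
    hup hfed

/-! ## §2 The two instance families sit at NON-FULL points -/

/-- **The vertex of the Fermat cubic cone `Σ xₗ³ = 0` (char 2) is NOT a FULL point**: `f = Σ xₗ·xₗ² ∈ (x₀², …, x_{n−1}²) = 𝔪^{[2]}`, `f^{p−1} = f`.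
[cite: Fedder1983, Prop. 1.7] -/
theorem fermatCubicCone_vertex_not_fullCl (k : Type) [Field k] [CharP k 2] (m : ℕ) (f : MvPolynomial (Fin (m + 3)) k)
    (hf : f = ∑ l : Fin (m + 3), X l ^ 3)
    (v : Spec (.of (MvPolynomial (Fin (m + 3)) k ⧸ Ideal.span {f})))
    (hv : v.asIdeal = Ideal.span (Set.range fun j : Fin (m + 3) => Ideal.Quotient.mk (Ideal.span {f}) (X j))) :
    ¬ FullCl 2 ((Spec (.of (MvPolynomial (Fin (m + 3)) k ⧸ Ideal.span {f}))).presheaf.stalk v) := by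
  haveI : Fact (Nat.Prime 2) := ⟨Nat.prime_two⟩
  refine not_fullCl_stalk_origin_of_fedder_mem 2 k f (FermatCubicConeChar2.prime_fermat k m f hf).ne_zero
    (FermatCubicConeGerm.constantCoeff_f k f hf) ?_ v hv
  rw [show (2 - 1 : ℕ) = 1 from rfl, pow_one, hf]
  exact Ideal.sum_mem _ fun l _ => by
    rw [pow_succ']
    exact Ideal.mul_mem_left _ _ (Ideal.subset_span ⟨l, rfl⟩)

/-- **The vertex of the double point `x₀² + Σ x_{l+1}³ = 0` (char 2) is NOT a FULL point**: `f = x₀² + Σ x_{l+1}·x_{l+1}² ∈ 𝔪^{[2]}`. [cite: Fedder1983, Prop. 1.7] -/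
theorem doublePoint_vertex_not_fullCl (k : Type) [Field k] [CharP k 2] (m : ℕ) (f : MvPolynomial (Fin (m + 4)) k)
    (hf : f = X 0 ^ 2 + ∑ l : Fin (m + 3), X l.succ ^ 3)
    (v : Spec (.of (MvPolynomial (Fin (m + 4)) k ⧸ Ideal.span {f})))
    (hv : v.asIdeal = Ideal.span (Set.range fun j : Fin (m + 4) => Ideal.Quotient.mk (Ideal.span {f}) (X j))) :
    ¬ FullCl 2 ((Spec (.of (MvPolynomial (Fin (m + 4)) k ⧸ Ideal.span {f}))).presheaf.stalk v) := by
  haveI : Fact (Nat.Prime 2) := ⟨Nat.prime_two⟩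
  refine not_fullCl_stalk_origin_of_fedder_mem 2 k f (DoublePointFermatCubicCharts.prime_f k m f hf).ne_zero
    (DoublePointFermatCubicGerm.constantCoeff_f k m f hf) ?_ v hv
  rw [show (2 - 1 : ℕ) = 1 from rfl, pow_one, hf]
  refine Ideal.add_mem _ (Ideal.subset_span ⟨0, rfl⟩) (Ideal.sum_mem _ fun l _ => ?_)
  rw [pow_succ']
  exact Ideal.mul_mem_left _ _ (Ideal.subset_span ⟨l.succ, rfl⟩)

/-! ## §3 The headlines with non-vacuity in front -/

/-- ★ **Fermat cubic cone (char 2, `n = m + 3 ≥ 3`): the vertex is a BAD point (`¬ FullCl 2 𝒪_{X,v}`) AND a positive instance of the germ form** — the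
conjunction of `fermatCubicCone_vertex_not_fullCl` with `FermatCubicConeGerm.fermatCubicCone_vertex_germ_instance`. TRIVIAL STRATUM (FULL via a regular model).
[folklore mathematics; OURS as a certificate] -/
theorem fermatCubicCone_vertex_bad_germ_instance (k : Type) [Field k] [CharP k 2] (m : ℕ) (f : MvPolynomial (Fin (m + 3)) k)
    (hf : f = ∑ l : Fin (m + 3), X l ^ 3)
    (v : Spec (.of (MvPolynomial (Fin (m + 3)) k ⧸ Ideal.span {f})))
    (hv : v.asIdeal = Ideal.span (Set.range fun j : Fin (m + 3) => Ideal.Quotient.mk (Ideal.span {f}) (X j))) :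
    ¬ FullCl 2 ((Spec (.of (MvPolynomial (Fin (m + 3)) k ⧸ Ideal.span {f}))).presheaf.stalk v) ∧
    IsClosed ({v} : Set (Spec (.of (MvPolynomial (Fin (m + 3)) k ⧸ Ideal.span {f})))) ∧
    v ∉ Scheme.regularLocus (Spec (.of (MvPolynomial (Fin (m + 3)) k ⧸ Ideal.span {f}))) ∧
    ringKrullDim ((Spec (.of (MvPolynomial (Fin (m + 3)) k ⧸ Ideal.span {f}))).presheaf.stalk v) = (m + 3 - 1 : ℕ) ∧
    (∀ s : Spec ((Spec (.of (MvPolynomial (Fin (m + 3)) k ⧸ Ideal.span {f}))).presheaf.stalk v), s ≠ closedPoint _ →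
      s ∈ Scheme.regularLocus (Spec ((Spec (.of (MvPolynomial (Fin (m + 3)) k ⧸ Ideal.span {f}))).presheaf.stalk v))) ∧
    (∀ s : Spec ((Spec (.of (MvPolynomial (Fin (m + 3)) k ⧸ Ideal.span {f}))).presheaf.stalk v),
      CMCl ((Spec ((Spec (.of (MvPolynomial (Fin (m + 3)) k ⧸ Ideal.span {f}))).presheaf.stalk v)).presheaf.stalk s)) ∧
    FInjectivizationGermAt 2 v :=
  ⟨fermatCubicCone_vertex_not_fullCl k m f hf v hv, FermatCubicConeGerm.fermatCubicCone_vertex_germ_instance (m + 3) (by omega) k f hf v hv⟩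

/-- ★ **Double point `x₀² + Σ x_{l+1}³` (char 2): the vertex is a BAD point (`¬ FullCl 2 𝒪_{X,v}`) AND a positive instance of the germ form** — the conjunction
of `doublePoint_vertex_not_fullCl` with `DoublePointFermatCubicGerm.doublePointFermatCubic_vertex_germ_instance`. INFORMATIVE STRATUM (the FULL model is not regular,
`DoublePointFermatCubicModelSingular.affineBlowup_doublePoint_full_and_not_regular`). [folklore mathematics; OURS as a certificate] -/
theorem doublePoint_vertex_bad_germ_instance (k : Type) [Field k] [CharP k 2] (m : ℕ) (f : MvPolynomial (Fin (m + 4)) k)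
    (hf : f = X 0 ^ 2 + ∑ l : Fin (m + 3), X l.succ ^ 3)
    (v : Spec (.of (MvPolynomial (Fin (m + 4)) k ⧸ Ideal.span {f})))
    (hv : v.asIdeal = Ideal.span (Set.range fun j : Fin (m + 4) => Ideal.Quotient.mk (Ideal.span {f}) (X j))) :
    ¬ FullCl 2 ((Spec (.of (MvPolynomial (Fin (m + 4)) k ⧸ Ideal.span {f}))).presheaf.stalk v) ∧
    IsClosed ({v} : Set (Spec (.of (MvPolynomial (Fin (m + 4)) k ⧸ Ideal.span {f})))) ∧
    v ∉ Scheme.regularLocus (Spec (.of (MvPolynomial (Fin (m + 4)) k ⧸ Ideal.span {f}))) ∧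
    ringKrullDim ((Spec (.of (MvPolynomial (Fin (m + 4)) k ⧸ Ideal.span {f}))).presheaf.stalk v) = (m + 3 : ℕ) ∧
    (∀ s : Spec ((Spec (.of (MvPolynomial (Fin (m + 4)) k ⧸ Ideal.span {f}))).presheaf.stalk v), s ≠ closedPoint _ →
      s ∈ Scheme.regularLocus (Spec ((Spec (.of (MvPolynomial (Fin (m + 4)) k ⧸ Ideal.span {f}))).presheaf.stalk v))) ∧
    (∀ s : Spec ((Spec (.of (MvPolynomial (Fin (m + 4)) k ⧸ Ideal.span {f}))).presheaf.stalk v),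
      CMCl ((Spec ((Spec (.of (MvPolynomial (Fin (m + 4)) k ⧸ Ideal.span {f}))).presheaf.stalk v)).presheaf.stalk s)) ∧
    FInjectivizationGermAt 2 v :=
  ⟨doublePoint_vertex_not_fullCl k m f hf v hv, DoublePointFermatCubicGerm.doublePointFermatCubic_vertex_germ_instance k m f hf v hv⟩

end Summit.ResolutionOfSingularities.ResolutionOfSingularities.Theorems.FInjectiveMacaulayfication.HypersurfaceOriginNotFull

end
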